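import Summits.ResolutionOfSingularities.ResolutionOfSingularities.Theorems.HilbertSamuelEliminationCampaignW42NearChainMoving
import Summits.ResolutionOfSingularities.ResolutionOfSingularities.Theorems.HilbertSamuelEliminationSigmaMaxModificationsCorridor3WLadderMovingCompactness
import Summits.ResolutionOfSingularities.ResolutionOfSingularities.Theorems.HilbertSamuelEliminationSigmaMaxModificationsCorridor3WMono
import HarnessLib

/-!
# [OURS · L1 W4.2] The O2-type items after L∞ and W-mono LANDED: the summit from the MOVING ROWS ALONE, and from the GRADED moving
# rows modulo CJS Thm. 3.10 (4); item 19965 from the lax tertiary-invariant slots modulo CJS Thm. 3.10 (4)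

Cell res-hironaka, slot W4.2 (★L-G4), statement campaign s42, seat res-L1-s42-pv-2 (gen 3); host route HilbertSamuelElimination (DRAFT);
pure proofs (`--supports stmt-ResolutionOfSingularities-19964`). AI bookkeeping, weaker than expert review. NOTHING here is a statement
of H. Hironaka's manuscript [Hironaka2017]; OURS rows enter as HYPOTHESES; the one printed input is the NAMED FACT
`CossartJannsenSaito2020_thm_3_10_4` (statement-only, p499783) where it is named.

Two chain landings of 2026-08-27 discharge the two structural hypotheses of `…CampaignW42NearChainMoving` (p499679):
* L∞ `Moving.MovingCompactness.{0}` is PROVED — registered stub `WLadder.stub_movingCompactness` (p500208; res-L1-w42-idea-2's line,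
  helpers res-type-005 p496952/p498054/p498231, res-type-064 p498069/p499423/p499814);
* W-mono at every level modulo CJS Thm. 3.10 (4) — `Helpers.closedOriginGeomDirDimNonincrease_of_thm_3_10_4` and the isolated-scope
  `Helpers.geomDirDimNonincrease_of_thm_3_10_4` (p500936, res-L1-w42-lead-1).

## What is proved (namespace `…Theorems.CampaignW42`; universe `0`, where L∞ lives)

* `nearChainTermination_offPhi_of_movingRows₀` — ITEM 19964 off `Φ^{(N)}` from the all-level ungraded moving rows ALONE.
* `sigmaMaxModifications_of_movingRows₀ : (∀ p prime, ∀ N, Moving.MaxOriginNoMovingNearChainAt p N ⊤) → SigmaMaxModifications` and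
  `resolutionOfSingularities_of_movingRows₀ : … → ResolutionOfSingularities` — THE SUMMIT FROM THE STARVATION-FREE O2-TYPE ROWS, no other
  hypothesis (conditional; credits nothing; the rows are OPEN from dimension three = obstruction O2 of CJS §1.3).
* `maxOriginNoMoving_top_of_grades` / `resolutionOfSingularities_of_gradedMovingRows : CossartJannsenSaito2020_thm_3_10_4 →
  (∀ p prime N, MaxOriginNoMovingNearChainAt p N (ē ≤ 2)) → (∀ p prime N, MaxOriginNoMovingNearChainAt p N (3 ≤ ē)) → ResolutionOfSingularities`
  — the graded form: printed Thm. 3.10 (4) + the low-grade moving rows (the printed key theorems' territory in dimension two; beyond print from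
  dimension three, where Thm. 6.40's «no regular curve in X_max through the point» is not automatic) + the top-grade moving rows (O2 proper).
* `tertiaryTermination_offPhi_of_laxSlots₀ : CossartJannsenSaito2020_thm_3_10_4 → (∀ e, TertiaryInvariantLaxExists p e) → [ITEM 19965 off Φ^{(N)}]`
  — the isolated item is EXACTLY «a Cossart–Schober-shaped lax tertiary invariant exists at every grade», modulo the printed Thm. 3.10 (4).

References: V. Cossart, U. Jannsen, S. Saito, LNM 2270 (2020), §1.3, Thm. 3.10 (4), Rem. 6.29 (1), p. 107, Cor. 6.18, Thm. 6.17
[CossartJannsenSaito2020]; CHAIN w42 v3.8a §0g; tree …CampaignW42NearChainMoving (p499679), …Corridor3WLadderMovingCompactness (p500208),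
…Corridor3WMono (p500936), `Literature/…/PermissibleBlowupDirectrix.lean` (p499783).
-/

noncomputable section

set_option linter.dupNamespace false -- mandated namespace of this single-conjunct summit

open CategoryTheory AlgebraicGeometry TopologicalSpace Topology

namespace Summit.ResolutionOfSingularities.ResolutionOfSingularities.Theorems

namespace CampaignW42

open Literature.AlgebraicGeometry.Resolution Literature.RingTheory.HilbertSamuel
open Summit.ResolutionOfSingularities.ResolutionOfSingularities.Theses.HilbertSamuelElimination
open Summit.ResolutionOfSingularities.ResolutionOfSingularities.Theorems.SigmaMaxModificationsCorridor3
open Summit.ResolutionOfSingularities.ResolutionOfSingularities.Theorems.SigmaMaxModificationsCorridor3.Moving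
open Summit.ResolutionOfSingularities.ResolutionOfSingularities.Theorems.SigmaMaxModificationsCorridor3.Helpers
  (closedOriginGeomDirDimNonincrease_of_thm_3_10_4 geomDirDimNonincrease_of_thm_3_10_4)
open Summit.ResolutionOfSingularities.ResolutionOfSingularities.Cruxes.SigmaMaxModificationsCorridor3.WLadder (stub_movingCompactness)

universe u v

variable {p : ℕ}

/-! ## Item 19964 and the summit from the ungraded moving rows alone (L∞ discharged by p500208) -/

/-- **ITEM 19964 off `Φ^{(N)}` FROM THE ALL-LEVEL MOVING ROWS ALONE** (p499679's `nearChainTermination_offPhi_of_movingRows` with L∞ supplied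
by the landed `WLadder.stub_movingCompactness`). [cite: CossartJannsenSaito2020, Rem. 6.29 (1), p. 107] -/
theorem nearChainTermination_offPhi_of_movingRows₀ (hM : ∀ N, MaxOriginNoMovingNearChainAt.{0} p N fun _ => True) :
    ∀ (R : ∀ S : Scheme.{0}, CentreSeq S → Prop), OracleFunctional R → OracleAdmissible R →
      ∀ (N : ℕ) (ν : ℕ → ℕ) (X : Scheme.{0}) [IsLocallyNoetherian X] (x : X), IsMaximalOrigin p N ν X x →
        ν ≠ iterPSum N Phi → NoNearChainFrom R N ν (MarkedStage.init X x) fun _ => True :=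
  nearChainTermination_offPhi_of_movingRows stub_movingCompactness hM

/-- **`SigmaMaxModifications` (stmt-…-18506) FROM THE MOVING ROWS ALONE.** Conditional; credits nothing.
[cite: CossartJannsenSaito2020, §1.3, Def. 6.15, Rem. 6.29 (1)] -/
theorem sigmaMaxModifications_of_movingRows₀
    (hM : ∀ p : ℕ, p.Prime → ∀ N, MaxOriginNoMovingNearChainAt.{0} p N fun _ => True) : SigmaMaxModifications :=
  sigmaMaxModifications_of_movingRows stub_movingCompactness hM

/-- **THE SUMMIT FROM THE STARVATION-FREE O2-TYPE ROWS ALONE: `(∀ p prime, ∀ N, MaxOriginNoMovingNearChainAt p N ⊤) → ResolutionOfSingularities`.**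
Conditional; credits nothing; the hypothesis is OPEN from dimension three (obstruction O2 of Cossart–Jannsen–Saito, typed MOVING).
[cite: CossartJannsenSaito2020, §1.3, Cor. 6.18, Thm. 6.17, Rem. 6.29 (1), p. 107] -/
theorem resolutionOfSingularities_of_movingRows₀
    (hM : ∀ p : ℕ, p.Prime → ∀ N, MaxOriginNoMovingNearChainAt.{0} p N fun _ => True) : _root_.ResolutionOfSingularities :=
  resolutionOfSingularities_of_movingRows stub_movingCompactness hM

/-! ## The graded form modulo CJS Thm. 3.10 (4) (W-mono by p500936) -/

/-- **GRADE JOIN at level `N` modulo CJS Thm. 3.10 (4)**: the low-grade (`ē ≤ 2`) and top-grade (`ē ≥ 3`) moving rows give the ungraded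
moving row (`Moving.maxOriginNoMovingNearChainAt_all_of_grades'` with `Helpers.closedOriginGeomDirDimNonincrease_of_thm_3_10_4`).
[cite: CossartJannsenSaito2020, Thm. 3.10 (4)] -/
theorem maxOriginNoMoving_top_of_grades (h310 : CossartJannsenSaito2020_thm_3_10_4.{u}) {N : ℕ}
    (hlow : MaxOriginNoMovingNearChainAt.{u} p N fun s => s.geomDirDim ≤ 2)
    (htop : MaxOriginNoMovingNearChainAt.{u} p N fun s => 3 ≤ s.geomDirDim) :
    MaxOriginNoMovingNearChainAt.{u} p N fun _ => True :=
  maxOriginNoMovingNearChainAt_all_of_grades' (closedOriginGeomDirDimNonincrease_of_thm_3_10_4 h310 p N) hlow htop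

/-- **THE SUMMIT, GRADED: CJS Thm. 3.10 (4) + the low-grade moving rows + the top-grade moving rows (all primes, all levels) ⇒
`ResolutionOfSingularities`.** Conditional; credits nothing: the fact is printed (statement-only in the tree), the low rows are the key
theorems' territory in dimension two and beyond print from dimension three, the top rows are obstruction O2.
[cite: CossartJannsenSaito2020, §1.3, Thm. 3.10 (4), Thm. 6.35, Thm. 6.40, p. 107] -/
theorem resolutionOfSingularities_of_gradedMovingRows (h310 : CossartJannsenSaito2020_thm_3_10_4.{0})
    (hlow : ∀ p : ℕ, p.Prime → ∀ N, MaxOriginNoMovingNearChainAt.{0} p N fun s => s.geomDirDim ≤ 2)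
    (htop : ∀ p : ℕ, p.Prime → ∀ N, MaxOriginNoMovingNearChainAt.{0} p N fun s => 3 ≤ s.geomDirDim) :
    _root_.ResolutionOfSingularities :=
  resolutionOfSingularities_of_movingRows₀ fun p hp N => maxOriginNoMoving_top_of_grades h310 (hlow p hp N) (htop p hp N)

/-- The same for the parent crux `SigmaMaxModifications` (stmt-…-18506). [cite: CossartJannsenSaito2020, §1.3, Thm. 3.10 (4), Def. 6.15] -/
theorem sigmaMaxModifications_of_gradedMovingRows (h310 : CossartJannsenSaito2020_thm_3_10_4.{0})
    (hlow : ∀ p : ℕ, p.Prime → ∀ N, MaxOriginNoMovingNearChainAt.{0} p N fun s => s.geomDirDim ≤ 2)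
    (htop : ∀ p : ℕ, p.Prime → ∀ N, MaxOriginNoMovingNearChainAt.{0} p N fun s => 3 ≤ s.geomDirDim) :
    SigmaMaxModifications :=
  sigmaMaxModifications_of_movingRows₀ fun p hp N => maxOriginNoMoving_top_of_grades h310 (hlow p hp N) (htop p hp N)

/-! ## Item 19965 from the lax tertiary-invariant slots, modulo CJS Thm. 3.10 (4) -/

/-- **ITEM 19965 off `Φ^{(N)}` FROM THE GRADED MOVING STATEMENTS, modulo CJS Thm. 3.10 (4)** (L∞ by p500208, `ē`-monotonicity at
isolated origins by `Helpers.geomDirDimNonincrease_of_thm_3_10_4`). [cite: CossartJannsenSaito2020, Thm. 3.10 (4), p. 107] -/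
theorem tertiaryTermination_offPhi_of_movingAt₀ (h310 : CossartJannsenSaito2020_thm_3_10_4.{0})
    (hmov : ∀ e, TertiaryTerminationMovingAt.{0} p e) :
    ∀ (R : ∀ S : Scheme.{0}, CentreSeq S → Prop), OracleFunctional R → OracleAdmissible R →
      ∀ (N : ℕ) (ν : ℕ → ℕ) (X : Scheme.{0}) [IsLocallyNoetherian X] (x : X), IsIsolatedOrigin p N ν X x →
        ν ≠ iterPSum N Phi → NoNearChainFrom R N ν (MarkedStage.init X x) fun _ => True :=
  tertiaryTermination_offPhi_of_movingAt stub_movingCompactness (geomDirDimNonincrease_of_thm_3_10_4 h310 p) hmov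

/-- **ITEM 19965 off `Φ^{(N)}` = «A LAX TERTIARY INVARIANT EXISTS AT EVERY GRADE», modulo CJS Thm. 3.10 (4)** (slots `TertiaryInvariantLaxExists p e`,
p474474; equivalence with the graded moving statements p476789). [cite: CossartJannsenSaito2020, §1.3, Thm. 3.10 (4), p. 107, App. Facts 18.28 (1)] -/
theorem tertiaryTermination_offPhi_of_laxSlots₀ (h310 : CossartJannsenSaito2020_thm_3_10_4.{0})
    (hlax : ∀ e, TertiaryInvariantLaxExists.{0, v} p e) :
    ∀ (R : ∀ S : Scheme.{0}, CentreSeq S → Prop), OracleFunctional R → OracleAdmissible R →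
      ∀ (N : ℕ) (ν : ℕ → ℕ) (X : Scheme.{0}) [IsLocallyNoetherian X] (x : X), IsIsolatedOrigin p N ν X x →
        ν ≠ iterPSum N Phi → NoNearChainFrom R N ν (MarkedStage.init X x) fun _ => True :=
  tertiaryTermination_offPhi_of_laxSlots stub_movingCompactness (geomDirDimNonincrease_of_thm_3_10_4 h310 p) hlax

/-! ## The three dimension-graded cruxes of the route by name, from the moving rows alone (appended 2026-08-27, same seat) -/

/-- **`SigmaMaxModificationsDimGe4` (stmt-ResolutionOfSingularities-19250, «from dimension four») FROM THE MOVING ROWS ALONE**: a restriction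
of `SigmaMaxModifications`. Conditional; credits nothing. [cite: CossartJannsenSaito2020, Def. 6.15, Rem. 6.29 (1)] -/
theorem sigmaMaxModificationsDimGe4_of_movingRows₀
    (hM : ∀ p : ℕ, p.Prime → ∀ N, MaxOriginNoMovingNearChainAt.{0} p N fun _ => True) : SigmaMaxModificationsDimGe4 := by
  intro p hp k _ _ X f hsep hft hqc hred hreg _ N hdim
  exact hsBody_of_offPhi (nearChainTermination_offPhi_of_movingRows₀ (hM p hp)) k N X f hsep hft hqc hred hreg hdim

/-- **`SigmaMaxModificationsLowDim` (stmt-ResolutionOfSingularities-19251) FROM THE MOVING ROWS ALONE** (here without the printed facts it is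
landed on conditionally in the tree). Conditional; credits nothing. [cite: CossartJannsenSaito2020, Def. 6.15, Rem. 6.29 (1)] -/
theorem sigmaMaxModificationsLowDim_of_movingRows₀
    (hM : ∀ p : ℕ, p.Prime → ∀ N, MaxOriginNoMovingNearChainAt.{0} p N fun _ => True) : SigmaMaxModificationsLowDim := by
  intro p hp k _ _ X f hsep hft hqc hred hreg N hdim _ _
  exact hsBody_of_offPhi (nearChainTermination_offPhi_of_movingRows₀ (hM p hp)) k N X f hsep hft hqc hred hreg hdim

/-- **`SigmaMaxModificationsCorridor3` (stmt-ResolutionOfSingularities-19249, the crux of the registered line `w_ladder`) FROM THE ALL-LEVEL MOVING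
ROWS ALONE** — WITHOUT the CJS surface fact (the rows at levels `≤ 2` stand in for it through the dimension induction). Conditional; credits
nothing; not the line's composition (which works at level 3 modulo printed facts), only its all-level envelope. [cite: CossartJannsenSaito2020, Def. 6.15, Rem. 6.29 (1)] -/
theorem sigmaMaxModificationsCorridor3_of_movingRows₀
    (hM : ∀ p : ℕ, p.Prime → ∀ N, MaxOriginNoMovingNearChainAt.{0} p N fun _ => True) : SigmaMaxModificationsCorridor3 := by
  intro p hp k _ _ X f hsep hft hqc hred hreg _ _ N hdim _ _
  exact hsBody_of_offPhi (nearChainTermination_offPhi_of_movingRows₀ (hM p hp)) k N X f hsep hft hqc hred hreg hdim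

/-- **Every item of route HilbertSamuelElimination at once from the moving rows**, through the route file's own glue `closes` with the proved
`ModificationsResolve_proof` (the same statement as `resolutionOfSingularities_of_movingRows₀`, routed through the route's deciding composition).
Conditional; credits nothing. [cite: CossartJannsenSaito2020, Rem. 6.29 (1), Cor. 6.18, Thm. 6.17] -/
theorem closes_of_movingRows₀
    (hM : ∀ p : ℕ, p.Prime → ∀ N, MaxOriginNoMovingNearChainAt.{0} p N fun _ => True) : _root_.ResolutionOfSingularities :=
  closes (sigmaMaxModificationsLowDim_of_movingRows₀ hM) (sigmaMaxModificationsCorridor3_of_movingRows₀ hM)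
    (sigmaMaxModificationsDimGe4_of_movingRows₀ hM) ModificationsResolve_proof

end CampaignW42

end Summit.ResolutionOfSingularities.ResolutionOfSingularities.Theorems

end
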